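import Summits.Parity.GeneralizedHardyLittlewood.Theorems.LeeYangFibresRelativeDimOneFloatingDefs
import Summits.Parity.GeneralizedHardyLittlewood.Theorems.LeeYangFibresRelativeDimOneTypeEndgame
import HarnessLib

/-!
# Route `LeeYangFibres`, crux `RelativeDimOne` (stmt-Parity-14113), line `floating-level-core`:
# the registered stub `stub_endgameFlat` — `∀ θ, 0 < θ → θ < 1 → EndgameFlat θ`

`EndgameFlat θ` (vocabulary `LeeYangFibresRelativeDimOneFloatingDefs`) is the landed assembly step `Endgame θ`
(`LeeYangFibresRelativeDimOneTypeEndgame`, `stub_endgame`) with the FLAT type data `TypeDataFlat θ` — the conditioning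
depth threshold `D₀` chosen AFTER the decay constant `C` and the accuracy `η` — in place of `TypeData θ`:
the core atom `IncidenceBandlimitedCoreDecay θ`, `TypeDataFlat θ`, `TypeRigidity` and `SingularWeightFacts` imply the
crux `RelativeDimOne` (the `Λ`-form of Green–Tao Conj. 1.4 at `d = 1`).

PROOF. A re-thread of the landed `stub_endgame` with the constants read off in the flat order. Fix `t, L, ε₀`
(w.l.o.g. `ε₀ ≤ 1`). Take the sizes `L₁ ≥ L` of `TypeDataFlat`, the threshold `D₂` of (W4), the core's decay constant
`C` at sizes `L₁`, the constant `C_w` of (W1), `κ = ε₀ / (16 C_w)`; NOW the threshold `D₁` of `TypeDataFlat` at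
`(C, κ)`, and `D = max (max D₁ D₂) 1`. For `N` large and a non-degenerate `Ψ = sys a b₀` with `‖Ψ‖_N ≤ L`,
`K ⊆ [-N, N]` convex:
* if `𝔖(Ψ) = 0`, (W2) gives `0 ≤ S ≤ ε₀ N` and the claim is trivial;
* otherwise let `f` be the core's spectrum at scale `N`, `hl = hlCoeff · a ·` (type-invariant, decay `1`) and
  `e = f a − hl` (type-invariant, decay `C + 1`). The type data give `|condSum (f a) − λ| ≤ κG` (`λ = ∏_{p ≤ w} β_p`),
  (R2) for `hl` and (W4) give `|condSum hl − λ| ≤ 2κG`, so `|condSum e| ≤ 3κG`; (R1), (R2) for `e` then give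
  `|F − H| ≤ 5κG ≤ 5κ C_w 𝔖 = (5/16) ε₀ 𝔖` by (W1), where `H = sfBand ⌊N^θ⌋ hl b₀`, `|𝔖 − H| ≤ ε₀/16` by the landed
  uniform Euler tail `BandlimitedProof.abs_sub_sum_squarefree_le`; finally the core clause at `(Ψ, K)` (accuracy
  `ε₀/16`) and `β_∞ ≤ 2N` (`archFactor_le_two_mul`) close `|S − β_∞ 𝔖| ≤ ε₀ (β_∞ 𝔖 + N)`
  (`EndgameProof.endgame_chain`).

References: Green–Tao, Ann. of Math. 171 (2010), Conj. 1.4 [GreenTao2010]; Gallagher, Mathematika 23 (1976) §2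
[Gallagher1976].
-/

noncomputable section

open scoped BigOperators Classical
open Finset Literature.NumberTheory.Sieve
open Summit.Parity.GeneralizedHardyLittlewood.Theses.LeeYangFibres (RelativeDimOne)
open Summit.Parity.GeneralizedHardyLittlewood.Cruxes.RelativeDimOne.GallagherBackwardsSplit
open Summit.Parity.GeneralizedHardyLittlewood.Cruxes.RelativeDimOne.GallagherBackwardsSplit.BandlimitedProof
  (abs_sub_sum_squarefree_le)
open Summit.Parity.GeneralizedHardyLittlewood.Cruxes.CellParityLaw.SectionAnnihilator.SingularRatio
  (singularProduct_nonneg)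
open Summit.Parity.GeneralizedHardyLittlewood.Theorems.AbsoluteUpgrade (archFactor_le_two_mul)
open Summit.Parity.GeneralizedHardyLittlewood.Theorems.LeeYangFibresRelativeDimOne (vonMangoldtSum_nonneg)
open Summit.Parity.GeneralizedHardyLittlewood.Cruxes.RelativeDimOne.TypeSplit
open Summit.Parity.GeneralizedHardyLittlewood.Cruxes.RelativeDimOne.TypeSplit.EndgameProof

namespace Summit.Parity.GeneralizedHardyLittlewood.Cruxes.RelativeDimOne.FloatingLevelCore

/-! ### The stub -/

/-- **`stub_endgameFlat`** (registered stub of the line `floating-level-core`): for every level `0 < θ < 1`, the core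
with decay `IncidenceBandlimitedCoreDecay θ`, the FLAT type data `TypeDataFlat θ` (depth threshold chosen after the
decay constant and the accuracy), `TypeRigidity` and `SingularWeightFacts` together imply the crux `RelativeDimOne`.
Pure assembly, the landed `TypeSplit.stub_endgame` re-threaded: read off `L₁`, then `D₂` (W4), `C` (core at sizes
`L₁`), `C_w` (W1), `κ = ε₀/(16 C_w)`, then `D₁` (flat type data at `(C, κ)`), `D = max (max D₁ D₂) 1`; (W2) settles
`𝔖(Ψ) = 0`; otherwise with `e = f a − hlCoeff · a ·` (type-invariant, decay `C + 1`) the type data + (R2 for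
`hlCoeff`) + (W4) bound `|condSum e| ≤ 3κ G_w`, (R1), (R2) give
`|sfBand (f a) b₀ − sfBand (hl a) b₀| ≤ 5κ G_w ≤ 5κ C_w 𝔖(Ψ)` (W1), the uniform Euler tail `abs_sub_sum_squarefree_le`
gives `|𝔖(Ψ) − sfBand (hl a) b₀| ≤ ε₀/16`, and the core clause at `(Ψ, K)` with `β_∞ ≤ 2N` closes
`|S − β_∞ 𝔖| ≤ ε₀ (β_∞ 𝔖 + N)`. [cite: GreenTao2010, Conj. 1.4] -/
theorem stub_endgameFlat : ∀ θ : ℝ, 0 < θ → θ < 1 → EndgameFlat θ := by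
  intro θ hθ0 _ hCore hData hRig hW t L ht ε₀' hε₀'
  obtain ⟨hW1, hW2, hW4, -⟩ := hW
  -- w.l.o.g. `ε₀ ≤ 1`
  obtain ⟨ε₀, hε₀def⟩ : ∃ ε₀ : ℝ, ε₀ = min ε₀' 1 := ⟨_, rfl⟩
  have hε₀ : 0 < ε₀ := by rw [hε₀def]; exact lt_min hε₀' one_pos
  have hε₀1 : ε₀ ≤ 1 := by rw [hε₀def]; exact min_le_right _ _
  have hε₀le : ε₀ ≤ ε₀' := by rw [hε₀def]; exact min_le_left _ _
  -- the constants `L₁`, `C`, `C_w`, `κ` (flat order: the depth threshold `D₁` comes AFTER `(C, κ)`)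
  obtain ⟨L₁, hLL₁, hDataF⟩ := hData t L ht
  obtain ⟨D₂, hW4'⟩ := hW4 t L θ hθ0
  obtain ⟨C, hC, hCore'⟩ := hCore t L₁ ht
  obtain ⟨Cw, hCw, hW1'⟩ := hW1 t ht
  obtain ⟨κ, hκdef⟩ : ∃ κ : ℝ, κ = ε₀ / (16 * Cw) := ⟨_, rfl⟩
  have hκ : 0 < κ := by rw [hκdef]; positivity
  have hκCw : κ * Cw = ε₀ / 16 := by
    rw [hκdef]
    field_simp
  have hC1 : 0 < C + 1 := by linarith
  have hη : 0 < ε₀ / 16 := by positivity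
  -- the depth `D`
  obtain ⟨D₁, hData'⟩ := hDataF C κ hC hκ
  obtain ⟨D, hDdef⟩ : ∃ D : ℕ, D = max (max D₁ D₂) 1 := ⟨_, rfl⟩
  have hD1 : 1 ≤ D := by omega
  have hDD₁ : D₁ ≤ D := by omega
  have hDD₂ : D₂ ≤ D := by omega
  -- the thresholds
  obtain ⟨N₁, hR⟩ := hRig t L D (C + 1) κ ht hD1 hC1 hκ
  obtain ⟨N₁', hR'⟩ := hRig t L D 1 κ ht hD1 one_pos hκ
  obtain ⟨ε₁, hε₁, N₂, hD'⟩ := hData' D hDD₁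
  obtain ⟨N₃, hW4''⟩ := hW4' D hDD₂ κ hκ
  obtain ⟨N₄, hW2'⟩ := hW2 t L ht ε₀ hε₀
  obtain ⟨N₅, hSSB⟩ := abs_sub_sum_squarefree_le t L hθ0 hη
  have hε' : 0 < min ε₁ (ε₀ / 16) := lt_min hε₁ hη
  obtain ⟨N₆, hCore''⟩ := hCore' (min ε₁ (ε₀ / 16)) hε'
  refine ⟨max 1 (max N₁ (max N₁' (max N₂ (max N₃ (max N₄ (max N₅ N₆)))))),
    fun N hN Ψ hΨ hL K hK hKN => ?_⟩
  simp only [max_le_iff] at hN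
  obtain ⟨hN1, hNN₁, hNN₁', hNN₂, hNN₃, hNN₄, hNN₅, hNN₆⟩ := hN
  -- `Ψ = sys a b₀`
  obtain ⟨a, b₀, rfl⟩ : ∃ a b₀, Ψ = sys a b₀ := ⟨coeffs Ψ, consts Ψ, (sys_coeffs_consts Ψ).symm⟩
  have hN0 : (0 : ℝ) ≤ N := Nat.cast_nonneg N
  have hA0 : 0 ≤ archFactor (sys a b₀) K := ENNReal.toReal_nonneg
  have hA2 : archFactor (sys a b₀) K ≤ 2 * (N : ℝ) := archFactor_le_two_mul _ hKN
  have hS0 : 0 ≤ singularProduct (sys a b₀) := singularProduct_nonneg hΨ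
  have hSv0 : 0 ≤ vonMangoldtSum (sys a b₀) K N := vonMangoldtSum_nonneg _ K N
  have htarget0 : 0 ≤ archFactor (sys a b₀) K * singularProduct (sys a b₀) + N := by positivity
  rcases eq_or_ne (singularProduct (sys a b₀)) 0 with h𝔖 | h𝔖
  · -- local obstruction: (W2) and `S ≥ 0`
    have hobs := hW2' N hNN₄ (sys a b₀) hΨ hL h𝔖 K hKN
    rw [h𝔖, mul_zero, sub_zero, zero_add, abs_of_nonneg hSv0]
    exact hobs.trans (mul_le_mul_of_nonneg_right hε₀le hN0)
  -- the main case `𝔖(Ψ) > 0`: sizes of `a`, `b₀`, and the core's spectrum `f` at scale `N`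
  obtain ⟨ha, hb⟩ := coeff_bounds hN1 hΨ hL
  obtain ⟨f, hInv, hDec, hApprox⟩ := hCore'' N hNN₆
  -- (TypeDataFlat) for `f a`
  have h1 : |condSum (level θ N) (wlev D N) a b₀ (f a) - singularProductPartial (sys a b₀) (wlev D N)|
      ≤ κ * gscale (wlev D N) a b₀ :=
    hD' N hNN₂ f hInv hDec (coreApprox_mono (min_le_left _ _) hApprox) a b₀ ha hb hΨ
  -- (R2) for the explicit spectrum `hl`
  have h2 : |condSum (level θ N) (wlev D N) a b₀ (fun q b => hlCoeff q a b)
        - smoothBand (level θ N) (wlev D N) (fun q b => hlCoeff q a b) b₀| ≤ κ * gscale (wlev D N) a b₀ :=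
    (hR' N hNN₁' (level θ N) a ha _ (typeInvariant_hl a) (hasDecay_hl a) b₀ hb hΨ).2.1
  -- (W4)
  have h3 : |smoothBand (level θ N) (wlev D N) (fun q b => hlCoeff q a b) b₀
        - singularProductPartial (sys a b₀) (wlev D N)| ≤ κ := hW4'' N hNN₃ a b₀ ha
  -- (R1), (R2) for `e = f a - hl` (type-invariant, decay `C + 1`), with `sfBand`, `condSum` expanded linearly
  have hRe := hR N hNN₁ (level θ N) a ha _ (typeInvariant_sub (hInv a) (typeInvariant_hl a))
    (hasDecay_sub (hDec a) (hasDecay_hl a)) b₀ hb hΨ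
  have h4 : |sfBand (level θ N) (f a) b₀ - sfBand (level θ N) (fun q b => hlCoeff q a b) b₀
        - smoothBand (level θ N) (wlev D N) (fun q b => f a q b - hlCoeff q a b) b₀|
      ≤ κ * gscale (wlev D N) a b₀ := by
    have := hRe.1
    rwa [sfBand_sub] at this
  have h5 : |condSum (level θ N) (wlev D N) a b₀ (f a) - condSum (level θ N) (wlev D N) a b₀ (fun q b => hlCoeff q a b)
        - smoothBand (level θ N) (wlev D N) (fun q b => f a q b - hlCoeff q a b) b₀|
      ≤ κ * gscale (wlev D N) a b₀ := by
    have := hRe.2.1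
    rwa [condSum_sub] at this
  -- (W1): `κ G ≤ κ C_w 𝔖 = (ε₀/16) 𝔖`, and `κ ≤ κ G`
  have hG1 := one_le_gscale (wlev D N) a b₀
  have hGW : gscale (wlev D N) a b₀ ≤ Cw * singularProduct (sys a b₀) := hW1' (wlev D N) a b₀ hΨ h𝔖
  have hκG : κ * gscale (wlev D N) a b₀ ≤ ε₀ / 16 * singularProduct (sys a b₀) := by
    calc κ * gscale (wlev D N) a b₀ ≤ κ * (Cw * singularProduct (sys a b₀)) :=
          mul_le_mul_of_nonneg_left hGW hκ.le
      _ = (κ * Cw) * singularProduct (sys a b₀) := by ring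
      _ = ε₀ / 16 * singularProduct (sys a b₀) := by rw [hκCw]
  have hκ1 : κ ≤ κ * gscale (wlev D N) a b₀ := le_mul_of_one_le_right hκ.le hG1
  -- hence `|F - H| ≤ 5 κ G ≤ 5 (ε₀/16) 𝔖`
  have hFH : |sfBand (level θ N) (f a) b₀ - sfBand (level θ N) (fun q b => hlCoeff q a b) b₀|
      ≤ 5 * (ε₀ / 16) * singularProduct (sys a b₀) := by
    rw [abs_le] at h1 h2 h3 h4 h5 ⊢
    obtain ⟨h1l, h1r⟩ := h1
    obtain ⟨h2l, h2r⟩ := h2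
    obtain ⟨h3l, h3r⟩ := h3
    obtain ⟨h4l, h4r⟩ := h4
    obtain ⟨h5l, h5r⟩ := h5
    constructor <;> linarith
  -- the uniform Euler tail: `|𝔖 - H| ≤ ε₀/16`
  have h6 : |singularProduct (sys a b₀) - sfBand (level θ N) (fun q b => hlCoeff q a b) b₀| ≤ ε₀ / 16 :=
    (hSSB N hNN₅ (sys a b₀) hΨ hL).2
  -- the core clause at `(Ψ, K)` with accuracy `ε₀/16`
  have hL₁ : affLinSize (sys a b₀) N ≤ L₁ := hL.trans (by exact_mod_cast hLL₁)
  have h7 := hApprox (sys a b₀) hΨ hL₁ K hK hKN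
  rw [coeffs_sys, consts_sys] at h7
  have h7' : |vonMangoldtSum (sys a b₀) K N - archFactor (sys a b₀) K * sfBand (level θ N) (f a) b₀|
      ≤ ε₀ / 16 * (archFactor (sys a b₀) K * |sfBand (level θ N) (f a) b₀| + N) :=
    h7.trans (mul_le_mul_of_nonneg_right (min_le_right _ _) (by positivity))
  have hη16 : ε₀ / 16 ≤ 1 / 16 := by linarith [hε₀1]
  -- the chain
  calc |vonMangoldtSum (sys a b₀) K N - archFactor (sys a b₀) K * singularProduct (sys a b₀)|
      ≤ 16 * (ε₀ / 16) * (archFactor (sys a b₀) K * singularProduct (sys a b₀) + N) :=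
        endgame_chain hA0 hA2 hS0 hN0 hη.le hη16 h7' hFH h6
    _ = ε₀ * (archFactor (sys a b₀) K * singularProduct (sys a b₀) + N) := by ring
    _ ≤ ε₀' * (archFactor (sys a b₀) K * singularProduct (sys a b₀) + N) :=
        mul_le_mul_of_nonneg_right hε₀le htarget0

end Summit.Parity.GeneralizedHardyLittlewood.Cruxes.RelativeDimOne.FloatingLevelCore

end
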